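import Literature.RingTheory.LocalCohomology.GrothendieckConnectednessProofs
import HarnessLib

/-!
# Venture HSemireg — two-colourings of the branches of a hypersurface in a complete local domain

The exact form of Grothendieck's connectedness theorem used in STEP (4) of THEOREM CC∞
(cell record `widen/W1/CLEAN-COMPONENT-THEOREM-w1tw1.md` §20): let `D` be a complete Noetherian local
DOMAIN of dimension `≥ k + 2` (`k ≥ 1`) and `t ∈ 𝔪_D`. Colour the irreducible components of the
hypersurface `Spec (D ⧸ (t))` with two colours, both used. Then two components `C₁, C₂` of different
colours meet in dimension `≥ k`: `dim (D ⧸ (t)) ⧸ (C₁ + C₂) ≥ k`. With `k = dim D − 2 = d − 1` for the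
`(d+1)`-dimensional completed local ring of the normalised support family this says: if the central
fibre had «A-side» and «B-side» branches, some A-branch would meet some B-branch in dimension
`≥ d − 1` — which codimension-`≥ 2` contact forbids.

* `twoColouring_hypersurface_of_isDomain` — the statement above, a direct specialisation of the tree
  theorem `Literature.RingTheory.LocalCohomology.GrothendieckConnectedness_holds` (SGA 2 XIII 2.1,
  proved in `GrothendieckConnectednessProofs.lean`) to a domain (`minimalPrimes D = {⊥}`, so the
  linking hypothesis (b_k) is vacuous) and one equation `fs = [t]`.

HONEST FRAMING. A corollary-by-specialisation of a kernel-proved Literature theorem; Lean index of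
one step of a NEGATIVE structure theorem of the computation cell `pub-hsemireg` (seat w1-tw-1, W1).
No scheme, sheaf, abelian variety or semiregularity map appears; nothing here says that HC, HC_CM
or HC_AV holds, and nothing here is a new case of anything.
-/

namespace Summit.Ventures.HSemireg

namespace BranchColouring

open IsLocalRing Literature.RingTheory.LocalCohomology

universe u

/-- **Two-colouring of the branches of a hypersurface in a complete local domain** (SGA 2 XIII 2.1,
`m = 1`, integral `X`): `D` a complete Noetherian local domain with `k + 2 ≤ dim D`, `1 ≤ k`,
`t ∈ 𝔪_D`; for every set `S` of primes of `D ⧸ (t)` containing some minimal prime and missing some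
minimal prime there are minimal primes `C₁ ∈ S`, `C₂ ∉ S` with `k ≤ dim (D ⧸ (t)) ⧸ (C₁ + C₂)`.
[cite: Grothendieck1968SGA2, Exp. XIII Thm. 2.1] -/
theorem twoColouring_hypersurface_of_isDomain (D : Type) [CommRing D] [IsDomain D]
    [IsNoetherianRing D] [IsLocalRing D] [IsAdicComplete (maximalIdeal D) D]
    (k : ℕ) (hk : 1 ≤ k) (hdim : ((k + 2 : ℕ) : WithBot ℕ∞) ≤ ringKrullDim D)
    (t : D) (ht : t ∈ maximalIdeal D)
    (S : Set (PrimeSpectrum (D ⧸ Ideal.ofList [t])))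
    (h₁ : ∃ C ∈ S, C.asIdeal ∈ minimalPrimes (D ⧸ Ideal.ofList [t]))
    (h₂ : ∃ C ∉ S, C.asIdeal ∈ minimalPrimes (D ⧸ Ideal.ofList [t])) :
    ∃ C₁ ∈ S, ∃ C₂ ∉ S, C₁.asIdeal ∈ minimalPrimes (D ⧸ Ideal.ofList [t]) ∧
      C₂.asIdeal ∈ minimalPrimes (D ⧸ Ideal.ofList [t]) ∧
      ((k : ℕ) : WithBot ℕ∞) ≤ ringKrullDim ((D ⧸ Ideal.ofList [t]) ⧸ (C₁.asIdeal ⊔ C₂.asIdeal)) := by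
  -- (a_k): the unique minimal prime `⊥` of the domain `D` has `dim D/⊥ = dim D ≥ k + 2`
  have ha : ∀ P : Ideal D, P ∈ minimalPrimes D →
      ((k + 2 : ℕ) : WithBot ℕ∞) ≤ ringKrullDim (D ⧸ P) := by
    intro P hP
    rw [IsDomain.minimalPrimes_eq_singleton_bot, Set.mem_singleton_iff] at hP
    subst hP
    rwa [ringKrullDim_eq_of_ringEquiv (RingEquiv.quotientBot D)]
  -- (b_k) is vacuous: a domain has one minimal prime, so no two-colouring uses both colours
  have hb : ∀ S' : Set (PrimeSpectrum D), (∃ C ∈ S', C.asIdeal ∈ minimalPrimes D) →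
      (∃ C ∉ S', C.asIdeal ∈ minimalPrimes D) →
        ∃ C₁ ∈ S', ∃ C₂ ∉ S', C₁.asIdeal ∈ minimalPrimes D ∧ C₂.asIdeal ∈ minimalPrimes D ∧
          ((k + 1 : ℕ) : WithBot ℕ∞) ≤ ringKrullDim (D ⧸ (C₁.asIdeal ⊔ C₂.asIdeal)) := by
    rintro S' ⟨C, hCS, hC⟩ ⟨C', hC'S, hC'⟩
    exfalso
    rw [IsDomain.minimalPrimes_eq_singleton_bot, Set.mem_singleton_iff] at hC hC'
    have : C = C' := PrimeSpectrum.ext (hC.trans hC'.symm)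
    exact hC'S (this ▸ hCS)
  have hfs : ∀ f ∈ [t], f ∈ maximalIdeal D := by simpa using ht
  have hlen : [t].length ≤ k := by simpa using hk
  obtain ⟨-, hconn⟩ := GrothendieckConnectedness_holds D k hk ha hb [t] hfs hlen
  obtain ⟨C₁, hC₁S, C₂, hC₂S, hC₁, hC₂, hle⟩ := hconn S h₁ h₂
  refine ⟨C₁, hC₁S, C₂, hC₂S, hC₁, hC₂, ?_⟩
  have hk' : k - [t].length + 1 = k := by simp; omega
  rwa [hk'] at hle

end BranchColouring

end Summit.Ventures.HSemireg
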